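import Mathlib
import Summits.BirchSwinnertonDyer.Rank2.LambdaTransportDoorAtTwo
import HarnessLib
import Literature.NumberTheory.EllipticCurves.KatoRankBound
import Literature.NumberTheory.EllipticCurves.KatoRankBoundProofs
import Literature.NumberTheory.EllipticCurves.Selmer
import Literature.NumberTheory.EllipticCurves.QuadraticTwist
import Literature.NumberTheory.EllipticCurves.AnalyticRank
import Literature.NumberTheory.EllipticCurves.Isogeny
import Literature.NumberTheory.EllipticCurves.LambdaInvariantCongruenceTransportAtTwo
import Literature.NumberTheory.EllipticCurves.Rank1Residual.Predicates
import Literature.NumberTheory.EllipticCurves.BSDSelmerParityDokchitserProofs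
import Summits.BirchSwinnertonDyer.Rank1Residual.X5.TwoAdicTargetsGVTransport
import Summits.BirchSwinnertonDyer.Rank2.Family81517MinimalOrdinary
import Summits.BirchSwinnertonDyer.Rank2.ParitySqueezeKernel
import Summits.BirchSwinnertonDyer.Rank2.Family81517Defs
import Summits.BirchSwinnertonDyer.BirchSwinnertonDyer.Theorems.TwoAdicConverseLambdaHalfCoeffCert
import Summits.BirchSwinnertonDyer.BirchSwinnertonDyer.Theorems.TwoAdicConverseLambdaHalfBridge
import Summits.BirchSwinnertonDyer.BirchSwinnertonDyer.Theorems.ByReductionTypeAtTwoOrdHalvesDefs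

/-!
# Rank2 kernel `LambdaTransportDoor` — FILE 2/2: the PROVED deciding chain of door (F*) (cell bsd-rank2 seat p2,
# route `TwoAdicLambdaTransport`, leaf T-r3₂ `Rank2.Family81517.SelmerCorankEqOrderEqThreeOnOddFamily`)

Verbatim the theorem part of p2 GEN 14's FINAL door `p2/g14/LambdaTransportDoorAtTwo.lean` (sha256 e3af19d0f81e…;
farm rc 0, 0 sorry), split from the statements (FILE 1/2 `Rank2/LambdaTransportDoorAtTwo.lean`, the `Prop` defs
`PublishedInputsAtTwo`, `FamilyFacts`, `RootNumberFacts`, `ReferenceFacts`, `LambdaFourMuZero`, `AnalyticOrderLEThree`,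
`AnalyticLambdaLEFour`, `MembersLambdaHalfAtTwo`, `MembersNonCM`, `ZeroAtMinusTwo`, `ZeroAtMinusTwoOnOddHalf`,
`ParitySqueezeKernel`) only to honour the tree's 400-line limit for files with proofs; filed by seat bsd-rank2-eng-2 GEN 4
per director-bsd g7 ruling (D′)(2) 2026-08-27T05:34:27Z («bank the kernel now»).

PROVED here: `familyFacts_of_tree`, `lambdaFourMuZero_of` (λ(X) = 4, μ = 0, X torsion for every member: Matsuno 6.2 at
`E″`, isogeny invariance to `E′`, Matsuno 4.2 = GV-at-2 transport `E′ ↦ E`), `algebraicHalf` (`s(E) = 3`, `s(E^{(2)}) = 1`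
on 𝓕₋), `analyticOrderLEThree_of_line`, `zeroAtMinusTwoOnOddHalf_of`, `leaf_of`, `closes_of_certificate`,
`analyticLambdaLEFour_of_members` (the 2adic cell's per-curve λ-half at a member + λ(X) = 4 ⇒ unit coefficient of
degree ≤ 4), `membersLambdaHalf_of_ordLambdaHalfAtTwo` (item stmt-BirchSwinnertonDyer-19556 ⇒ crux),
`membersLambdaHalf_of_ordEisensteinHalfAtTwo` (dedup support per ruling (A)(3): X5/O1 Eisenstein half ⇒ crux), and the
deciding theorems `closes : PublishedInputsAtTwo → RootNumberFacts → ReferenceFacts → MembersLambdaHalfAtTwo →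
ZeroAtMinusTwo → SelmerCorankEqOrderEqThreeOnOddFamily`, `closes_of_ordLambdaHalfAtTwo`.
B1 honesty (director-bsd 2026-08-27T04:43Z (4)): the leaf is the ORDER part of 2-adic BSD at rank 3 on a density-zero
family — no Mordell–Weil rank 3, no analytic rank, nothing at odd p, nothing on 𝓕₊; S0's number does not move.
PARTITION: none — r_an ≥ 2, summit axis S0; TWIN (D-0056): n/a. THEOREMS ONLY (no definition, no named fact, no `sorry`).
Source: cell bsd-rank2 HOME `p2/PADIC-R2-G14.md` §2–§4, `p2/g14/SketchG14.lean`, `p2/g14/LambdaTransportDoorAtTwo.lean`.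
-/


set_option linter.dupNamespace false

noncomputable section

open PowerSeries WeierstrassCurve Literature.NumberTheory.EllipticCurves
  Literature.NumberTheory.EllipticCurves.ModularForms
  Literature.NumberTheory.EllipticCurves.Greenberg1999
  Literature.NumberTheory.EllipticCurves.Rank1Residual

namespace Summit.BirchSwinnertonDyer.Rank2.LambdaTransportDoor

open Summit.BirchSwinnertonDyer.Rank2.Family81517

/-! ### Bridge to lit's PROVED family facts (`Rank2/Family81517MinimalOrdinary`, ℕ-parameters) -/

open Summit.BirchSwinnertonDyer.Rank2 in
/-- `FamilyFacts` from the tree theorems `isElliptic_family81517_model`, `isGloballyMinimal_family81517_model`,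
`isOrdinaryAt_two_family81517_model'`, `two_le_mordellWeilRank_family81517_model` (lit GEN 14, p488998–p490632),
`isElliptic_quadraticTwist`, and the support item `RootNumberFacts`. No Modularity needed. -/
theorem familyFacts_of_tree (hRN : RootNumberFacts) : FamilyFacts := by
  intro j n hA
  obtain ⟨hj, hm, hn, -, hq, hr⟩ := id hA
  have hm0 : 0 ≤ mOf j := by unfold mOf; omega
  have hq0 : 0 ≤ qOf j n := by unfold qOf; positivity
  have hr0 : 0 ≤ rOf j n := by unfold rOf; positivity
  have hmZ : ((mOf j).natAbs : ℤ) = mOf j := Int.natAbs_of_nonneg hm0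
  have hqZ : ((qOf j n).natAbs : ℤ) = qOf j n := Int.natAbs_of_nonneg hq0
  have hrZ : ((rOf j n).natAbs : ℤ) = rOf j n := Int.natAbs_of_nonneg hr0
  have hm' : (mOf j).natAbs.Prime := Int.prime_iff_natAbs_prime.mp hm
  have hq' : (qOf j n).natAbs.Prime := Int.prime_iff_natAbs_prime.mp hq
  have hr' : (rOf j n).natAbs.Prime := Int.prime_iff_natAbs_prime.mp hr
  have hq_eq : ((qOf j n).natAbs : ℤ) = (mOf j).natAbs + 64 * n ^ 2 := by
    rw [hqZ, hmZ]; unfold qOf mOf; ring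
  have hr_eq : ((rOf j n).natAbs : ℤ) = (mOf j).natAbs + 289 * n ^ 2 := by
    rw [hrZ, hmZ]; unfold rOf mOf; ring
  have hA' : 4 * ((-(34 * (j + 8 * n ^ 2)) - 13 : ℤ)) = -17 * ((qOf j n).natAbs : ℤ) - 1 := by
    rw [hqZ]; unfold qOf; ring
  have hcurve : curve j n =
      (⟨1, (((-(34 * (j + 8 * n ^ 2)) - 13 : ℤ) : ℤ) : ℚ), 0,
        ((((qOf j n).natAbs : ℤ) * (rOf j n).natAbs : ℤ) : ℚ), 0⟩ : WeierstrassCurve ℚ) := by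
    rw [hqZ, hrZ]; rfl
  have hpar := hRN j n hA
  have hEt : (twistTwo j n).IsElliptic := by
    haveI : (curve j n).IsElliptic := by
      rw [hcurve]; exact isElliptic_family81517_model (n := n) hm' hq' hr' hq_eq hr_eq hA'
    exact isElliptic_quadraticTwist (curve j n) two_ne_zero
  rw [hcurve] at hpar ⊢
  exact ⟨isElliptic_family81517_model (n := n) hm' hq' hr' hq_eq hr_eq hA',
    isGloballyMinimal_family81517_model hm' hq' hr' hq_eq hr_eq hA', hEt,
    isOrdinaryAt_two_family81517_model hm' hq' hr' hn hq_eq hr_eq hA',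
    two_le_mordellWeilRank_family81517_model hm' hq' hr' hn hq_eq hr_eq hA', hpar⟩

/-! ### The deciding chain (kernel-checked; no `sorry`) -/

open Summit.BirchSwinnertonDyer.Rank1Residual.X5.O1 in
/-- `λ = 4`, `μ = 0`, torsion for every admissible member, from Matsuno 4.2/6.2 + Greenberg 5.14 (named
facts inside `PublishedInputsAtTwo`) and the elementary `ReferenceFacts`, via the 2adic cell's PROVED
`reference_invariants_of_isogenous_fullTwoTorsion` (at `E″ → E′`) and `isTorsion_mu_lambda_of_gvTransport`
(at `E′ ⇝ E`). -/
theorem lambdaFourMuZero_of (hIn : PublishedInputsAtTwo) (hR : ReferenceFacts) : LambdaFourMuZero := by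
  rintro j n hA hE hmin κ γ hκ hγ D
  obtain ⟨-, -, ⟨h42, h62, h514⟩, -⟩ := id hIn
  obtain ⟨_, _, _, _, _, _, hgo, hgo1, hgo2, ⟨hP2, hram2, hnodd2⟩,
    ⟨h01, h02, h12, hT0, hT1, hT2⟩, hiso, ⟨hP1, hodd1, hnram1⟩, ⟨huE, hu1, hsq, hAB⟩, hn⟩ := hR j n hA
  have h2'' : 2 * (-(25 * mOf j : ℚ) / 8) + (refFull j n).a₁ * ((25 * mOf j : ℚ) / 4) +
      (refFull j n).a₃ = 0 := by
    show 2 * (-(25 * mOf j : ℚ) / 8) + 1 * ((25 * mOf j : ℚ) / 4) + 0 = 0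
    ring
  have h2' : 2 * (0 : ℚ) + (refOne j n).a₁ * 0 + (refOne j n).a₃ = 0 := by
    show 2 * (0 : ℚ) + 1 * 0 + 0 = 0
    ring
  have hinv : ∀ (κ : ZpExtension ℚ 2) (γ : Field.absoluteGaloisGroup ℚ), κ.IsCyclotomic →
      κ.IsTopGenerator γ → ∀ D' : (refOne j n).SelmerDualData κ γ,
        D'.IsTorsion ∧ D'.mu = 0 ∧
          D'.lambda = matsunoLambdaLawAtTwo ((refFull j n).conductorNorm ℤ) - 2 :=
    fun κ γ hκ hγ D' ↦
      reference_invariants_of_isogenous_fullTwoTorsion h62 h514 hgo2 hP2 h2'' (Or.inl ⟨hram2, hnodd2⟩)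
        ⟨_, _, _, h01, h02, h12, hT0, hT1, hT2⟩ hgo1 hP1 h2' (Or.inr ⟨hodd1, hnram1⟩) hiso hκ hγ D'
  have href : IsLambdaReferenceAtTwo (curve j n) 0 (refOne j n) 0
      (matsunoLambdaLawAtTwo ((refFull j n).conductorNorm ℤ) - 2) :=
    ⟨hgo1, huE, hu1, hsq, hAB, hinv⟩
  exact isTorsion_mu_lambda_of_gvTransport (curve j n) h42 hgo href hn hκ hγ D

/-- THE ALGEBRAIC HALF (no analytic crux): on `𝓕₋`, `corank Sel_{2^∞}(E/ℚ) = 3` and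
`corank Sel_{2^∞}(E^{(2)}/ℚ) = 1`. -/
theorem algebraicHalf (hIn : PublishedInputsAtTwo) (hF : FamilyFacts) (hR : ReferenceFacts) :
    ∀ j n : ℤ, AdmissibleF j n → OddSign j n →
      (curve j n).selmerCorank 2 = 3 ∧ (twistTwo j n).selmerCorank 2 = 1 := by
  intro j n hA hS
  obtain ⟨-, -, -, h19, hMon, -⟩ := id hIn
  obtain ⟨hE, hmin, hEt, hord, hrk, hpar⟩ := hF j n hA
  obtain ⟨hparE, hparT⟩ := hpar hS
  obtain ⟨κ, hκ, γ, hγ, -⟩ := exists_isCyclotomic_isTopGenerator_isCyclotomicVariable_holds 2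
  obtain ⟨D⟩ := (curve j n).nonempty_selmerDualData_holds κ γ hγ
  obtain ⟨hX, -, hlam⟩ := lambdaFourMuZero_of hIn hR j n hA hE hmin κ γ hκ hγ D
  have hsum : (curve j n).selmerCorank 2 + (twistTwo j n).selmerCorank 2 ≤ 4 := by
    have h := h19 (curve j n) hord κ γ hκ hγ D hX
    rw [hlam] at h
    exact h
  have hrs := (curve j n).selmerCorank_eq_mordellWeilRank_add_holds 2
  have hmE : (curve j n).selmerCorank 2 % 2 = (curve j n).analyticRank % 2 := hMon (curve j n)
  have hmT : (twistTwo j n).selmerCorank 2 % 2 = (twistTwo j n).analyticRank % 2 := hMon (twistTwo j n)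
  omega

/-- The K_F3 LINE closes the crux: Kato (`≥ corank = 3`) + `λ_an ≤ 4` + the zero at `T = −2` squeeze
`ord_{T=0} L₂ = 3`. -/
theorem analyticOrderLEThree_of_line (hIn : PublishedInputsAtTwo) (hF : FamilyFacts)
    (hR : ReferenceFacts) (h3 : AnalyticLambdaLEFour) (h6 : ZeroAtMinusTwoOnOddHalf)
    (hPSK : ParitySqueezeKernel) : AnalyticOrderLEThree := by
  intro j n hA hS hmin N _ f hf
  obtain ⟨hE, -⟩ := hF j n hA
  obtain ⟨hs3, -⟩ := algebraicHalf hIn hF hR j n hA hS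
  obtain ⟨c, g, hc, hg, hi⟩ := h3 j n hA hmin f hf
  have hlow : (3 : ℕ∞) ≤ (padicLFunction f (@unitRoot (curve j n) hmin 2 _ : ℚ_[2])).order := by
    have h := hIn.1 j n hA hmin f hf
    rw [hs3] at h
    exact_mod_cast h
  exact (hPSK _ c g hc hg (h6 j n hA hS hmin f hf c g hg) hi hlow).le

/-- The support `RootNumberFacts` (odd analytic rank of `E^{(2)}` on `𝓕₋`) feeds crux 3 its positivity hypothesis. -/
theorem zeroAtMinusTwoOnOddHalf_of (hRN : RootNumberFacts) (h6 : ZeroAtMinusTwo) :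
    ZeroAtMinusTwoOnOddHalf := by
  intro j n hA hS hmin N _ f hf c g hg
  have hodd := (hRN j n hA hS).2
  exact h6 j n hA (by omega) hmin f hf c g hg

/-- DECIDING THEOREM of the door: fact pack + two elementary support packs + the ONE crux ⇒ Leaf_F₋. -/
theorem leaf_of (hIn : PublishedInputsAtTwo) (hF : FamilyFacts) (hR : ReferenceFacts)
    (hK : AnalyticOrderLEThree) : SelmerCorankEqOrderEqThreeOnOddFamily := by
  refine ⟨hIn.2.1, fun j n hA hS ↦ ?_⟩
  obtain ⟨hE, -⟩ := hF j n hA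
  obtain ⟨hs3, -⟩ := algebraicHalf hIn hF hR j n hA hS
  refine ⟨hs3, fun hmin N _ f hf ↦ le_antisymm (hK j n hA hS hmin f hf) ?_⟩
  have h := hIn.1 j n hA hmin f hf
  rw [hs3] at h
  exact_mod_cast h

/-- SHAPE (β) DECIDING THEOREM as it would stand in `glue.lean` (with `Rank2.paritySqueezeKernel`, LANDED p488343). -/
theorem closes_of_certificate (hIn : PublishedInputsAtTwo) (hRN : RootNumberFacts) (hR : ReferenceFacts)
    (h3 : AnalyticLambdaLEFour) (h6 : ZeroAtMinusTwo) : SelmerCorankEqOrderEqThreeOnOddFamily :=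
  leaf_of hIn (familyFacts_of_tree hRN) hR
    (analyticOrderLEThree_of_line hIn (familyFacts_of_tree hRN) hR h3 (zeroAtMinusTwoOnOddHalf_of hRN h6)
      Summit.BirchSwinnertonDyer.Rank2.paritySqueezeKernel)

section Bridge19556

open Summit.BirchSwinnertonDyer.Rank1Residual.X1.MuLambda
  Summit.BirchSwinnertonDyer.BirchSwinnertonDyer.Theorems.TwoAdicTwistConverse

/-- **The S3 object decides the family's analytic crux**: `MembersLambdaHalfAtTwo` (the `λ`-half leaf of the 2adic
cell, per member) + the typed facts (`λ(X) = 4`, `μ = 0`: `lambdaFourMuZero_of`; Carayol) ⟹ the certificate form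
`AnalyticLambdaLEFour` (a unit coefficient of degree `≤ 4` in the `2`-free part of the integral multiple `L₀`). -/
theorem analyticLambdaLEFour_of_members (hIn : PublishedInputsAtTwo) (hF : FamilyFacts) (hR : ReferenceFacts)
    (hL : MembersLambdaHalfAtTwo) : AnalyticLambdaLEFour := by
  classical
  obtain ⟨-, -, -, -, -, hCar⟩ := id hIn
  intro j n hA hmin N _ f hf
  obtain ⟨hE, hminF, hEt, hord, hrk, hpar⟩ := hF j n hA
  haveI := hE; haveI := hmin
  have hN : N = (curve j n).conductorNorm ℤ := hCar hf
  subst hN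
  obtain ⟨κ, hκ, γ, hγ, hγv⟩ := exists_isCyclotomic_isTopGenerator_isCyclotomicVariable_holds 2
  obtain ⟨D⟩ := (curve j n).nonempty_selmerDualData_holds κ γ hγ
  obtain ⟨c, L₀, hL₀0, hι, hlam⟩ := hL j n hA hE hmin κ γ hκ hγ hγv hord f hf D
  obtain ⟨-, -, hlam4⟩ := lambdaFourMuZero_of hIn hR j n hA hE hmin κ γ hκ hγ D
  -- the `2`-free part `g` of `L₀`: `μ(g) = 0`, `λ(g) = λ(L₀) ≤ λ(X) = 4`, unit coefficient in degree `λ(g)`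
  have hg0 : red (pfree L₀) ≠ 0 := red_pfree_ne_zero hL₀0
  have hdec : pfree L₀ = PowerSeries.C ((2 : ℤ_[2]) ^ 0) * pfree L₀ := by simp
  obtain ⟨hmu0, hpf⟩ := mu_eq_and_pfree_eq hg0 hdec
  have hgne : pfree L₀ ≠ 0 := pfree_ne_zero hL₀0
  have hunit : IsUnit (PowerSeries.coeff (lam (pfree L₀)) (pfree L₀)) :=
    isUnit_coeff_lam_of_mu_eq_zero hgne hmu0
  have hlamg : lam (pfree L₀) = lam L₀ := by
    show (red (pfree (pfree L₀))).order.toNat = (red (pfree L₀)).order.toNat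
    rw [hpf]
  have hc : (c : ℚ_[2]) ≠ 0 := by
    intro hc
    apply hL₀0
    apply iwasawaToPowerSeries_injective 2
    rw [hι, hc, map_zero, zero_mul, map_zero]
  have hpow : ((2 : ℚ_[2]) ^ mu L₀) ≠ 0 := pow_ne_zero _ two_ne_zero
  have hmap : (pfree L₀).map (PadicInt.Coe.ringHom (p := 2)) = iwasawaToPowerSeries 2 (pfree L₀) := by
    ext k
    simp [PowerSeries.coeff_map]
  have h2 : iwasawaToPowerSeries 2 L₀ =
      PowerSeries.C ((2 : ℚ_[2]) ^ mu L₀) * iwasawaToPowerSeries 2 (pfree L₀) := by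
    conv_lhs => rw [eq_C_pow_mu_mul_pfree L₀]
    rw [map_mul]
    congr 1
    rw [iwasawaToPowerSeries, PowerSeries.map_C, map_pow, map_natCast, Nat.cast_ofNat]
  refine ⟨(c : ℚ_[2]) / (2 : ℚ_[2]) ^ mu L₀, pfree L₀, div_ne_zero hc hpow, ?_, lam (pfree L₀), by omega, hunit⟩
  rw [hmap]
  calc iwasawaToPowerSeries 2 (pfree L₀)
      = PowerSeries.C (((2 : ℚ_[2]) ^ mu L₀)⁻¹) *
          (PowerSeries.C ((2 : ℚ_[2]) ^ mu L₀) * iwasawaToPowerSeries 2 (pfree L₀)) := by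
        rw [← mul_assoc, ← map_mul, inv_mul_cancel₀ hpow, map_one, one_mul]
    _ = PowerSeries.C (((2 : ℚ_[2]) ^ mu L₀)⁻¹) * (PowerSeries.C (c : ℚ_[2]) *
          padicLFunction f (unitRoot (curve j n) 2 : ℚ_[2])) := by rw [← h2, hι]
    _ = PowerSeries.C ((c : ℚ_[2]) / (2 : ℚ_[2]) ^ mu L₀) *
          padicLFunction f (unitRoot (curve j n) 2 : ℚ_[2]) := by
        rw [← mul_assoc, ← map_mul, div_eq_mul_inv, mul_comm ((c : ℚ_[2]))]

/-- **One line from the 2adic cell's crux**: `OrdLambdaHalfAtTwo` (item stmt-BirchSwinnertonDyer-19556, route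
TwoAdicConverse) ⟹ `MembersLambdaHalfAtTwo` (members are non-CM and good ordinary at `2`). -/
theorem membersLambdaHalf_of_ordLambdaHalfAtTwo (hR : ReferenceFacts) (hCM : MembersNonCM)
    (h : OrdLambdaHalfAtTwo) : MembersLambdaHalfAtTwo := by
  intro j n hA hE hmin
  obtain ⟨hE', hmin', h1, h2, h3, h4, hgood, -⟩ := hR j n hA
  exact @h (curve j n) hE hmin (hCM j n hA hE) hgood

/-- DEDUP SUPPORT (director-bsd ruling 2026-08-27T04:43Z (3)): the 2adic cell's registered PARENT objects imply the crux —
PUBLISHED 2-adic inputs ∧ `OrdEisensteinHalfAtTwo` (item stmt-BirchSwinnertonDyer-19272 = the Eisenstein/Skinner–Urban half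
`X5.O1.MainConjectureEisensteinDivisibilityAtTwo` for every non-CM good-ordinary-at-2 curve) ⟹ `OrdLambdaHalfAtTwo` (item 19556,
tree `ordLambdaHalfAtTwo_of_ordEisensteinHalfAtTwo`) ⟹ `MembersLambdaHalfAtTwo`. So crux 2 is a strictly weaker SLICE of the
2adic cell's S3/19272 objects (this route is a consumer, not a rival). [cite: GreenbergVatsal2000, p. 4 (after Thm. (1.2))] -/
theorem membersLambdaHalf_of_ordEisensteinHalfAtTwo
    (hP : Literature.Uncategorized.OrdConversePublishedInputsAtTwo) (hR : ReferenceFacts) (hCM : MembersNonCM)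
    (hE : Summit.BirchSwinnertonDyer.BirchSwinnertonDyer.Theorems.OrdHalvesAtTwo.OrdEisensteinHalfAtTwo) :
    MembersLambdaHalfAtTwo :=
  membersLambdaHalf_of_ordLambdaHalfAtTwo hR hCM
    (Summit.BirchSwinnertonDyer.BirchSwinnertonDyer.Theorems.TwoAdicTwistConverse.ordLambdaHalfAtTwo_of_ordEisensteinHalfAtTwo
      hP hE)

end Bridge19556

/-- SHAPE (β) DECIDING THEOREM as it would stand in `glue.lean` (G14b: crux 2 = `MembersLambdaHalfAtTwo`, the S3
object on the family; `Rank2.paritySqueezeKernel` LANDED p488343). -/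
theorem closes (hIn : PublishedInputsAtTwo) (hRN : RootNumberFacts) (hR : ReferenceFacts)
    (hL : MembersLambdaHalfAtTwo) (h6 : ZeroAtMinusTwo) : SelmerCorankEqOrderEqThreeOnOddFamily :=
  leaf_of hIn (familyFacts_of_tree hRN) hR
    (analyticOrderLEThree_of_line hIn (familyFacts_of_tree hRN) hR
      (analyticLambdaLEFour_of_members hIn (familyFacts_of_tree hRN) hR hL) (zeroAtMinusTwoOnOddHalf_of hRN h6)
      Summit.BirchSwinnertonDyer.Rank2.paritySqueezeKernel)

/-- … and the same door keyed DIRECTLY on the 2adic cell's registered crux (item 19556). -/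
theorem closes_of_ordLambdaHalfAtTwo (hIn : PublishedInputsAtTwo) (hRN : RootNumberFacts) (hR : ReferenceFacts)
    (hCM : MembersNonCM)
    (h19556 : Summit.BirchSwinnertonDyer.BirchSwinnertonDyer.Theorems.TwoAdicTwistConverse.OrdLambdaHalfAtTwo)
    (h6 : ZeroAtMinusTwo) : SelmerCorankEqOrderEqThreeOnOddFamily :=
  closes hIn hRN hR (membersLambdaHalf_of_ordLambdaHalfAtTwo hR hCM h19556) h6

end Summit.BirchSwinnertonDyer.Rank2.LambdaTransportDoor

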